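import Literature.AnabelianGeometry.SemiGraphs.PSCCompactifiedNodeBridge
import Literature.AnabelianGeometry.SemiGraphs.PSCCoveringMapAlong
import Literature.AnabelianGeometry.SemiGraphs.PSCVertexBijectionEquivariance
import Literature.AnabelianGeometry.SemiGraphs.PSCGraphicProofs
import Mathlib.Logic.Equiv.Sum
import Mathlib.Tactic.Group
import HarnessLib

/-!
# [CombGC] Thm. 1.6 (ii), "we may assume `Σ = {l}`": the level packages from a GRAPHIC pro-`l` shadow

Mochizuki, *A combinatorial version of the Grothendieck conjecture*, Tohoku Math. J. **59** (2007)
[CombGC], proof of Theorem 1.6, author's manuscript p. 13 l.−8…−4 ("Since the … subgroups may be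
recovered as the stabilizers of [vertices, edges] of finite étale coverings … we may assume that
`Σ = {l}`") and p. 14.  Row T16-L04b («general-`Σ` (ii)») of the abc-iut cell's sub-DAG for Thm. 1.6
(`plan/L3/SUBDAG-CombGC-Thm16.md`; booked by the writer abc-iut-w4-d052 as a residual).

THE SHADOW-GRAPHICITY ROUTE.  At an open normal level `U ⊴ Π_G` with `U' = α(U)`, let
`g : U ↠ Q`, `g' : U' ↠ Q'` be presentations (intended: of the maximal pro-`l` quotients, abc-iut-L3-t4's
`IsMaxProSigmaQuotient`) and `ᾱ : Q ≅ Q'` over `α|_U`; the SHADOWS are the image data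
`D := (G.restrictBD U hU bd).mapAlong g …`, `D'` (abc-iut-L3-t4's `restrictBD` / `mapAlong`: same level
semi-graph, subgroups the images `g(U ∩ x Π_v x⁻¹)`, …).  If `ᾱ` is GRAPHIC between the shadows
(`IsGraphicVia`, e.g. by the `Σ = {l}` case of Thm. 1.6 (ii) applied to `(D, D', ᾱ)`), then pulling the
graph isomorphism back along `g'` (abc-iut-w5-d188's `pullF_map_map` / `pullF_conj` / `pullF_injective`,
generic in the presentation) yields, with `K' := (ker g')↑ ⊴ Π_H`, exactly the level-`U` data consumed by
abc-iut-w5-d188's descents `isGroupTheoreticallyVerticial_of_graphic_mod` /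
`isGroupTheoreticallyEdgeLike_of_graphic_mod` (`PSCVertexBijectionEquivariance.lean`): a bijection of the
level-`U` vertex [edge] sets which is `α`-graphic modulo `K'`, and separation modulo `K'` of distinct
level-`U'` vertices [edges] of `H` — the latter from Prop. 1.2 (i) for `D'`
(`VerticialOpenInterDeterminesVertex`, `EdgeLikeOpenInterDeterminesEdge`).

* `graphicMod_of_mk_eq` — changing representatives of the double cosets in an `α`-graphic-mod-`K'`
  relation (abc-iut-w5-d188's step (R1), isolated);
* `graphic_mod_bijection_of_reps` — GENERIC: a bijection of the ENUMERATED level classes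
  (`Σ i, dcFin U (S i)`) which is `α`-graphic modulo `K'` at the canonical representatives `dcRep`
  induces a bijection of the level classes `α`-graphic modulo `K'` at all representatives;
* `sep_mod_ker_of_shadow` — GENERIC: separation modulo `(ker g')↑` from "conjugate shadows with open
  intersection belong to the same level class";
* `graphicMod_of_shadow_conj` — one shadow conjugacy `ᾱ(g(U ∩ X^x)) = γ · g'(U' ∩ Y^y) · γ⁻¹` pulled back:
  `α(U ⊓ X^x) · K'` is `U'`-conjugate to `(U' ⊓ Y^y) · K'`;
* `vertex_package_of_isGraphicVia_shadow`, `edge_package_of_isGraphicVia_shadow` — the two level-`U`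
  packages from `D.IsGraphicVia D' ᾱ ι` and Prop. 1.2 (i) for `D'`.

Pure group theory over the interface (no origin, any `Σ`); proof-only, 0 defs; nothing here takes a side
on [IUTchIII] Cor. 3.12. [cite: MochizukiCombGC2007, Thm 1.6(ii) p.14]
[cite: MochizukiCombGC2007, Thm 1.6(i) p.13]
-/

noncomputable section

namespace Literature.AnabelianGeometry.SemiGraphs

namespace PSCDatum

open scoped Pointwise
open PSCCovering

universe u

variable {P : Type u} [Group P] [TopologicalSpace P]
variable {P' : Type u} [Group P'] [TopologicalSpace P']
variable {Q : Type u} [Group Q] [TopologicalSpace Q]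
variable {Q' : Type u} [Group Q'] [TopologicalSpace Q']

/-! ### 1. Changing representatives in an `α`-graphic-mod-`K'` relation -/

section Reps

variable (α : P ≃ₜ* P') {ι ι' : Type*} (S : ι → Subgroup P) (T : ι' → Subgroup P')
variable {U : Subgroup P} {U' : Subgroup P'} {K' : Subgroup P'}

/-- **(R1) Changing representatives.**  If `α(U ⊓ S_i^x) · K'` is `U'`-conjugate to `(U' ⊓ T_j^y) · K'`
and `U x S_i = U x' S_i`, `U' y T_j = U' y' T_j`, then the same holds for `x'`, `y'` (`U`, `U'`, `K'`
normal, `α(U) = U'`).  abc-iut-w5-d188's step (R1) of `graphic_mod_package_unr`, isolated.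
[cite: MochizukiCombGC2007, Thm 1.6(ii) p.14] -/
theorem graphicMod_of_mk_eq (hU : U.Normal) (hU' : U'.Normal)
    (hUU' : U.map α.toMulEquiv.toMonoidHom = U') (hK' : K'.Normal) {i : ι} {x x' : P} {j : ι'}
    {y y' : P'}
    (h : ∃ u' ∈ U', (U ⊓ ConjAct.toConjAct x • S i).map α.toMulEquiv.toMonoidHom ⊔ K' =
      ConjAct.toConjAct u' • ((U' ⊓ ConjAct.toConjAct y • T j) ⊔ K'))
    (hx : DoubleCoset.mk U (S i) x = DoubleCoset.mk U (S i) x')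
    (hy : DoubleCoset.mk U' (T j) y = DoubleCoset.mk U' (T j) y') :
    ∃ u' ∈ U', (U ⊓ ConjAct.toConjAct x' • S i).map α.toMulEquiv.toMonoidHom ⊔ K' =
      ConjAct.toConjAct u' • ((U' ⊓ ConjAct.toConjAct y' • T j) ⊔ K') := by
  obtain ⟨u', hu', h⟩ := h
  obtain ⟨u₁, hu₁, h₁⟩ := exists_conj_of_mk_eq hU (S i) hx
  obtain ⟨u₂, hu₂, h₂⟩ := exists_conj_of_mk_eq hU' (T j) hy
  have hαu₁ : α u₁ ∈ U' := by rw [← hUU']; exact ⟨u₁, hu₁, rfl⟩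
  refine ⟨α u₁ * u' * u₂⁻¹, U'.mul_mem (U'.mul_mem hαu₁ hu') (U'.inv_mem hu₂), ?_⟩
  rw [h₁, map_conj_smul, ← conjAct_smul_sup_of_normal hK']
  change ConjAct.toConjAct (α u₁) • _ = _
  rw [h, h₂, ← conjAct_smul_sup_of_normal hK', ← mul_smul, ← mul_smul, ← map_mul, ← map_mul]
  congr 2
  group

/-! ### 2. The bijection of level classes from a bijection of ENUMERATED classes, graphic at representatives -/

variable [U.FiniteIndex] [U'.FiniteIndex]

omit [TopologicalSpace P] [TopologicalSpace P'] in
/-- The class of `x` and its index: `U (dcRep (dcIdx x)) K = U x K`. [cite: MochizukiCombGC2007, Def 1.1(ii) p.6] -/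
theorem mk_dcRep_dcIdx (K : Subgroup P) (x : P) :
    DoubleCoset.mk U K (dcRep U K (dcIdx U K x)) = DoubleCoset.mk U K x := by
  obtain ⟨u, hu, k, hk, h⟩ := exists_dcRep_dcIdx_eq U K x
  exact ((DoubleCoset.eq _ _ _ _).mpr ⟨u, hu, k, hk, h⟩).symm

/-- **GENERIC: a bijection of the enumerated level classes, `α`-graphic modulo `K'` at the canonical
representatives, induces a bijection of the level classes which is `α`-graphic modulo `K'` at ALL
representatives** (the shape consumed by abc-iut-w5-d188's descent theorems).  Families `S` (of `Π_G`)
and `T` (of `Π_H`), `U ⊴ Π_G`, `U' = α(U) ⊴ Π_H`, `K' ⊴ Π_H`. [cite: MochizukiCombGC2007, Thm 1.6(ii) p.14] -/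
theorem graphic_mod_bijection_of_reps (hU : U.Normal) (hU' : U'.Normal)
    (hUU' : U.map α.toMulEquiv.toMonoidHom = U') (hK' : K'.Normal)
    (φ : (Σ i, dcFin U (S i)) ≃ (Σ j, dcFin U' (T j)))
    (hφ : ∀ w : Σ i, dcFin U (S i), ∃ u' ∈ U',
      (U ⊓ ConjAct.toConjAct (dcRep U (S w.1) w.2) • S w.1).map α.toMulEquiv.toMonoidHom ⊔ K' =
        ConjAct.toConjAct u' •
          ((U' ⊓ ConjAct.toConjAct (dcRep U' (T (φ w).1) (φ w).2) • T (φ w).1) ⊔ K')) :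
    ∃ e : (Σ i, DoubleCoset.Quotient (U : Set P) (S i : Set P)) ≃
        (Σ j, DoubleCoset.Quotient (U' : Set P') (T j : Set P')),
      ∀ (i : ι) (x : P) (j : ι') (y : P'),
        e ⟨i, DoubleCoset.mk U (S i) x⟩ = ⟨j, DoubleCoset.mk U' (T j) y⟩ →
          ∃ u' ∈ U', (U ⊓ ConjAct.toConjAct x • S i).map α.toMulEquiv.toMonoidHom ⊔ K' =
            ConjAct.toConjAct u' • ((U' ⊓ ConjAct.toConjAct y • T j) ⊔ K') := by
  refine ⟨(Equiv.sigmaCongrRight fun i => dcEnum U (S i)).trans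
    (φ.trans (Equiv.sigmaCongrRight fun j => (dcEnum U' (T j)).symm)), fun i x j y hexy => ?_⟩
  -- the class of `x` goes to the class of `y`: `φ ⟨i, dcIdx x⟩ = ⟨j, dcIdx y⟩`
  have key : φ ⟨i, dcIdx U (S i) x⟩ = ⟨j, dcIdx U' (T j) y⟩ := by
    apply (Equiv.sigmaCongrRight fun j => (dcEnum U' (T j)).symm).injective
    have h1 : ((Equiv.sigmaCongrRight fun i => dcEnum U (S i)).trans
        (φ.trans (Equiv.sigmaCongrRight fun j => (dcEnum U' (T j)).symm))) ⟨i, DoubleCoset.mk U (S i) x⟩ =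
        (Equiv.sigmaCongrRight fun j => (dcEnum U' (T j)).symm) (φ ⟨i, dcIdx U (S i) x⟩) := rfl
    rw [← h1, hexy]
    change (⟨j, DoubleCoset.mk U' (T j) y⟩ : Σ j, DoubleCoset.Quotient (U' : Set P') (T j : Set P')) =
      ⟨j, (dcEnum U' (T j)).symm (dcEnum U' (T j) (DoubleCoset.mk U' (T j) y))⟩
    rw [Equiv.symm_apply_apply]
  -- the relation at the canonical representatives, moved to `x`, `y`
  obtain ⟨u', hu', hrel⟩ := hφ ⟨i, dcIdx U (S i) x⟩
  rw [key] at hrel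
  have hrel' : ∃ u' ∈ U', (U ⊓ ConjAct.toConjAct (dcRep U (S i) (dcIdx U (S i) x)) • S i).map
      α.toMulEquiv.toMonoidHom ⊔ K' = ConjAct.toConjAct u' •
        ((U' ⊓ ConjAct.toConjAct (dcRep U' (T j) (dcIdx U' (T j) y)) • T j) ⊔ K') := ⟨u', hu', hrel⟩
  exact graphicMod_of_mk_eq α S T hU hU' hUU' hK' hrel' (mk_dcRep_dcIdx (S i) x) (mk_dcRep_dcIdx (T j) y)

end Reps

/-! ### 3. Pulling back along the presentation `g' : U' ↠ Q'` -/

section Pull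

variable (α : P ≃ₜ* P') {ι' : Type*} (T : ι' → Subgroup P')
variable {U : Subgroup P} {U' : Subgroup P'} [U'.FiniteIndex]
variable (g : U →* Q) (g' : U' →* Q')

omit [U'.FiniteIndex] in
/-- **One shadow conjugacy, pulled back.**  If `ᾱ(g(U ∩ x X x⁻¹)) = γ · g'(U' ∩ y Y y⁻¹) · γ⁻¹` in `Q'`
(`ᾱ` over `αU = α|_U`, `g'` surjective), then `α(U ⊓ X^x) · (ker g')↑` is `U'`-conjugate to
`(U' ⊓ Y^y) · (ker g')↑` in `Π_H` (abc-iut-w5-d188's `pullF_map_map` / `pullF_conj` / `pullF_map`).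
[cite: MochizukiCombGC2007, Thm 1.6(ii) p.14] -/
theorem graphicMod_of_shadow_conj (hs' : Function.Surjective g')
    (αU : U ≃ₜ* U') (hαU : ∀ u : U, ((αU u : U') : P') = α u)
    (ᾱ : Q ≃ₜ* Q') (hᾱ : ∀ u : U, ᾱ (g u) = g' (αU u))
    {x : P} {X : Subgroup P} {y : P'} {Y : Subgroup P'} {γ : ConjAct Q'}
    (h : (((ConjAct.toConjAct x • X).subgroupOf U).map g).map ᾱ.toMulEquiv.toMonoidHom =
      γ • ((ConjAct.toConjAct y • Y).subgroupOf U').map g') :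
    ∃ u' ∈ U', (U ⊓ ConjAct.toConjAct x • X).map α.toMulEquiv.toMonoidHom ⊔ g'.ker.map U'.subtype =
      ConjAct.toConjAct u' • ((U' ⊓ ConjAct.toConjAct y • Y) ⊔ g'.ker.map U'.subtype) := by
  obtain ⟨ũ, hũ⟩ := hs' (ConjAct.ofConjAct γ)
  refine ⟨ũ, ũ.2, ?_⟩
  have hγ : γ = ConjAct.toConjAct (g' ũ) := by rw [hũ, ConjAct.toConjAct_ofConjAct]
  have key := congrArg (fun Z : Subgroup Q' => (Z.comap g').map U'.subtype) h
  rw [pullF_map_map α αU hαU ᾱ.toMulEquiv (fun u => hᾱ u), hγ, pullF_conj, pullF_map,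
    Subgroup.subgroupOf_map_subtype, Subgroup.subgroupOf_map_subtype, inf_comm, inf_comm _ U'] at key
  exact key

variable [U.FiniteIndex]

omit [TopologicalSpace P'] in
/-- **GENERIC separation modulo `(ker g')↑` from the shadows.**  Let `V w` (`w` a level-`U'` class
`U' y T_j`, enumerated) be the shadow `g'(U' ∩ y_w T_j y_w⁻¹)` of its canonical representative subgroup, and
suppose conjugate shadows with open intersection come from the same class (Prop. 1.2 (i) for the shadow
datum).  Then `(U' ⊓ T_{j₁}^{y₁}) · (ker g')↑` `U'`-conjugate to `(U' ⊓ T_{j₂}^{y₂}) · (ker g')↑` forces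
`U' y₁ T_{j₁} = U' y₂ T_{j₂}` (`j₁ = j₂`). [cite: MochizukiCombGC2007, Prop 1.2(i) p.8] -/
theorem sep_mod_ker_of_shadow (hU' : U'.Normal) (hs' : Function.Surjective g')
    (hKn : (g'.ker.map U'.subtype).Normal)
    (V : (Σ j, dcFin U' (T j)) → Subgroup Q')
    (hV : ∀ w, ((ConjAct.toConjAct (dcRep U' (T w.1) w.2) • T w.1).subgroupOf U').map g' = V w)
    (hsep : ∀ (w₁ w₂ : Σ j, dcFin U' (T j)) (γ₁ γ₂ : ConjAct Q'),
      IsOpen (((γ₁ • V w₁ ⊓ γ₂ • V w₂).subgroupOf (γ₁ • V w₁) : Subgroup (γ₁ • V w₁ : Subgroup Q')) :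
        Set (γ₁ • V w₁ : Subgroup Q')) → w₁ = w₂)
    (j₁ : ι') (y₁ : P') (j₂ : ι') (y₂ : P')
    (h : ∃ u' ∈ U', (U' ⊓ ConjAct.toConjAct y₁ • T j₁) ⊔ g'.ker.map U'.subtype =
      ConjAct.toConjAct u' • ((U' ⊓ ConjAct.toConjAct y₂ • T j₂) ⊔ g'.ker.map U'.subtype)) :
    (⟨j₁, DoubleCoset.mk U' (T j₁) y₁⟩ : Σ j, DoubleCoset.Quotient (U' : Set P') (T j : Set P')) =
      ⟨j₂, DoubleCoset.mk U' (T j₂) y₂⟩ := by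
  obtain ⟨u', hu', h⟩ := h
  -- the canonical representatives of the two classes
  obtain ⟨u₁, hu₁, h₁⟩ :=
    exists_conj_of_mk_eq hU' (T j₁) (mk_dcRep_dcIdx (U := U') (T j₁) y₁).symm
  obtain ⟨u₂, hu₂, h₂⟩ :=
    exists_conj_of_mk_eq hU' (T j₂) (mk_dcRep_dcIdx (U := U') (T j₂) y₂).symm
  -- the two shadows are conjugate by `g'(u₁ u' u₂⁻¹)`
  set c : U' := ⟨u₁ * u' * u₂⁻¹, U'.mul_mem (U'.mul_mem hu₁ hu') (U'.inv_mem hu₂)⟩ with hc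
  have hconj : V ⟨j₁, dcIdx U' (T j₁) y₁⟩ = ConjAct.toConjAct (g' c) • V ⟨j₂, dcIdx U' (T j₂) y₂⟩ := by
    apply pullF_injective U' g' hs'
    rw [pullF_conj, ← hV, ← hV, pullF_map, pullF_map, Subgroup.subgroupOf_map_subtype,
      Subgroup.subgroupOf_map_subtype, inf_comm, inf_comm _ U']
    dsimp only
    rw [h₁, h₂, ← conjAct_smul_sup_of_normal hKn, ← conjAct_smul_sup_of_normal hKn, h, ← mul_smul,
      ← mul_smul, hc]
    congr 1
    change ConjAct.toConjAct u₁ * ConjAct.toConjAct u' = ConjAct.toConjAct (u₁ * u' * u₂⁻¹) * ConjAct.toConjAct u₂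
    rw [← map_mul, ← map_mul]
    congr 1
    group
  -- hence the classes coincide
  have heq : (⟨j₁, dcIdx U' (T j₁) y₁⟩ : Σ j, dcFin U' (T j)) = ⟨j₂, dcIdx U' (T j₂) y₂⟩ := by
    refine hsep _ _ 1 (ConjAct.toConjAct (g' c)) ?_
    have htop : ((1 : ConjAct Q') • V ⟨j₁, dcIdx U' (T j₁) y₁⟩ ⊓
        ConjAct.toConjAct (g' c) • V ⟨j₂, dcIdx U' (T j₂) y₂⟩).subgroupOf
        ((1 : ConjAct Q') • V ⟨j₁, dcIdx U' (T j₁) y₁⟩) = ⊤ := by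
      rw [Subgroup.subgroupOf_eq_top, one_smul]
      exact le_inf le_rfl hconj.le
    rw [htop, Subgroup.coe_top]
    exact isOpen_univ
  obtain ⟨hj, hidx⟩ := Sigma.mk.inj_iff.mp heq
  subst hj
  have hmk : DoubleCoset.mk U' (T j₁) y₁ = DoubleCoset.mk U' (T j₁) y₂ :=
    (dcEnum U' (T j₁)).injective (eq_of_heq hidx)
  rw [hmk]

end Pull

/-! ### 4. The two level packages from a graphic shadow -/

section Shadow

variable [IsTopologicalGroup P] [IsTopologicalGroup P'] [T2Space Q] [T2Space Q']
variable (G : PSCDatum P) (H : PSCDatum P') (α : P ≃ₜ* P')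
variable (U : Subgroup P) [U.FiniteIndex] [U.Normal] (hU : IsOpen (U : Set P)) (bd : G.BranchData)
variable (U' : Subgroup P') [U'.FiniteIndex] [U'.Normal] (hU' : IsOpen (U' : Set P')) (bd' : H.BranchData)
variable [CompactSpace U] [CompactSpace U']
variable (g : U →* Q) (hg : Continuous g) (S : Set ℕ) (hSG : S ⊆ G.Sigma) (hQ : IsProSigma S Q)
variable (g' : U' →* Q') (hg' : Continuous g') (hs' : Function.Surjective g') (hSH : S ⊆ H.Sigma)
  (hQ' : IsProSigma S Q')
variable (hUU' : U.map α.toMulEquiv.toMonoidHom = U')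
variable (αU : U ≃ₜ* U') (hαU : ∀ u : U, ((αU u : U') : P') = α u)
variable (ᾱ : Q ≃ₜ* Q') (hᾱ : ∀ u : U, ᾱ (g u) = g' (αU u))
variable (hKn : (g'.ker.map U'.subtype).Normal)

include hs' hUU' hαU hᾱ hKn in
/-- **The level-`U` VERTEX package from a graphic shadow.**  If `ᾱ` is graphic between the shadows
`D = (G_U)` along `g` and `D' = (H_{U'})` along `g'` via `ι`, and Prop. 1.2 (i) (verticial case) holds for
`D'`, then there are a bijection `Vert(G_U) ≃ Vert(H_{U'})` which is `α`-graphic modulo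
`K' := (ker g')↑ ⊴ Π_H` and separation modulo `K'` — the hypothesis of abc-iut-w5-d188's
`isGroupTheoreticallyVerticial_of_graphic_mod` at the level `U`. [cite: MochizukiCombGC2007, Thm 1.6(ii) p.14] -/
theorem vertex_package_of_isGraphicVia_shadow (hne : S.Nonempty)
    (ι₀ : PSCSemiGraph.Iso ((G.restrictBD U hU bd).mapAlong g hg S hSG hne hQ).graph
      ((H.restrictBD U' hU' bd').mapAlong g' hg' S hSH hne hQ').graph)
    (hvia : ((G.restrictBD U hU bd).mapAlong g hg S hSG hne hQ).IsGraphicVia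
      ((H.restrictBD U' hU' bd').mapAlong g' hg' S hSH hne hQ') ᾱ ι₀)
    (hV : ((H.restrictBD U' hU' bd').mapAlong g' hg' S hSH hne hQ').VerticialOpenInterDeterminesVertex) :
    ∃ (K' : Subgroup P') (_ : K'.Normal)
      (e : (Σ v, DoubleCoset.Quotient (U : Set P) (G.vertGp v : Set P)) ≃
        (Σ w, DoubleCoset.Quotient (U' : Set P') (H.vertGp w : Set P'))),
      (∀ (v : G.graph.V) (x : P) (w : H.graph.V) (y : P'),
        e ⟨v, DoubleCoset.mk U (G.vertGp v) x⟩ = ⟨w, DoubleCoset.mk U' (H.vertGp w) y⟩ →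
          ∃ u' ∈ U', (U ⊓ ConjAct.toConjAct x • G.vertGp v).map α.toMulEquiv.toMonoidHom ⊔ K' =
            ConjAct.toConjAct u' • ((U' ⊓ ConjAct.toConjAct y • H.vertGp w) ⊔ K')) ∧
      (∀ (w₁ : H.graph.V) (y₁ : P') (w₂ : H.graph.V) (y₂ : P'),
        (∃ u' ∈ U', (U' ⊓ ConjAct.toConjAct y₁ • H.vertGp w₁) ⊔ K' =
            ConjAct.toConjAct u' • ((U' ⊓ ConjAct.toConjAct y₂ • H.vertGp w₂) ⊔ K')) →
          (⟨w₁, DoubleCoset.mk U' (H.vertGp w₁) y₁⟩ :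
              Σ w, DoubleCoset.Quotient (U' : Set P') (H.vertGp w : Set P')) =
            ⟨w₂, DoubleCoset.mk U' (H.vertGp w₂) y₂⟩) := by
  -- the graph isomorphism on vertices, graphic at the canonical representatives
  have hφ : ∀ w : Σ v, dcFin U (G.vertGp v), ∃ u' ∈ U',
      (U ⊓ ConjAct.toConjAct (dcRep U (G.vertGp w.1) w.2) • G.vertGp w.1).map α.toMulEquiv.toMonoidHom ⊔
          g'.ker.map U'.subtype =
        ConjAct.toConjAct u' • ((U' ⊓ ConjAct.toConjAct
          (dcRep U' (H.vertGp (ι₀.vertEquiv w).1) (ι₀.vertEquiv w).2) • H.vertGp (ι₀.vertEquiv w).1) ⊔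
            g'.ker.map U'.subtype) := by
    intro w
    obtain ⟨γ, hγ⟩ := hvia.1 w
    exact graphicMod_of_shadow_conj α g g' hs' αU hαU ᾱ hᾱ hγ
  obtain ⟨e, he⟩ := graphic_mod_bijection_of_reps α G.vertGp H.vertGp inferInstance inferInstance hUU' hKn
    ι₀.vertEquiv hφ
  refine ⟨g'.ker.map U'.subtype, hKn, e, he, fun w₁ y₁ w₂ y₂ h => ?_⟩
  exact sep_mod_ker_of_shadow H.vertGp g' inferInstance hs' hKn
    ((H.restrictBD U' hU' bd').mapAlong g' hg' S hSH hne hQ').vertGp (fun w => rfl) hV w₁ y₁ w₂ y₂ h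

include hs' hUU' hαU hᾱ hKn in
/-- **The level-`U` EDGE package from a graphic shadow** (nodes and cusps together, indexed by
`N ⊕ C` with `edgeGp`): a bijection `Edge(G_U) ≃ Edge(H_{U'})` which is `α`-graphic modulo
`K' := (ker g')↑` and separation modulo `K'`, from graphicity of `ᾱ` between the shadows and Prop. 1.2 (i)
(edge-like case) for `D'` — the hypothesis of abc-iut-w5-d188's `isGroupTheoreticallyEdgeLike_of_graphic_mod`
at the level `U`. [cite: MochizukiCombGC2007, Thm 1.6(ii) p.14] -/
theorem edge_package_of_isGraphicVia_shadow (hne : S.Nonempty)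
    (ι₀ : PSCSemiGraph.Iso ((G.restrictBD U hU bd).mapAlong g hg S hSG hne hQ).graph
      ((H.restrictBD U' hU' bd').mapAlong g' hg' S hSH hne hQ').graph)
    (hvia : ((G.restrictBD U hU bd).mapAlong g hg S hSG hne hQ).IsGraphicVia
      ((H.restrictBD U' hU' bd').mapAlong g' hg' S hSH hne hQ') ᾱ ι₀)
    (hE : ((H.restrictBD U' hU' bd').mapAlong g' hg' S hSH hne hQ').EdgeLikeOpenInterDeterminesEdge) :
    ∃ (K' : Subgroup P') (_ : K'.Normal)
      (e : (Σ c, DoubleCoset.Quotient (U : Set P) (G.edgeGp c : Set P)) ≃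
        (Σ c', DoubleCoset.Quotient (U' : Set P') (H.edgeGp c' : Set P'))),
      (∀ (c : G.graph.N ⊕ G.graph.C) (x : P) (c' : H.graph.N ⊕ H.graph.C) (y : P'),
        e ⟨c, DoubleCoset.mk U (G.edgeGp c) x⟩ = ⟨c', DoubleCoset.mk U' (H.edgeGp c') y⟩ →
          ∃ u' ∈ U', (U ⊓ ConjAct.toConjAct x • G.edgeGp c).map α.toMulEquiv.toMonoidHom ⊔ K' =
            ConjAct.toConjAct u' • ((U' ⊓ ConjAct.toConjAct y • H.edgeGp c') ⊔ K')) ∧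
      (∀ (c₁ : H.graph.N ⊕ H.graph.C) (y₁ : P') (c₂ : H.graph.N ⊕ H.graph.C) (y₂ : P'),
        (∃ u' ∈ U', (U' ⊓ ConjAct.toConjAct y₁ • H.edgeGp c₁) ⊔ K' =
            ConjAct.toConjAct u' • ((U' ⊓ ConjAct.toConjAct y₂ • H.edgeGp c₂) ⊔ K')) →
          (⟨c₁, DoubleCoset.mk U' (H.edgeGp c₁) y₁⟩ :
              Σ c', DoubleCoset.Quotient (U' : Set P') (H.edgeGp c' : Set P')) =
            ⟨c₂, DoubleCoset.mk U' (H.edgeGp c₂) y₂⟩) := by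
  -- the edge classes at level `U`, as a sum of node classes and cusp classes
  let σG : (Σ c : G.graph.N ⊕ G.graph.C, dcFin U (G.edgeGp c)) ≃
      (Σ e : G.graph.N, dcFin U (G.nodeGp e)) ⊕ (Σ c : G.graph.C, dcFin U (G.cuspGp c)) :=
    Equiv.sumSigmaDistrib fun c => dcFin U (G.edgeGp c)
  let σH : (Σ c' : H.graph.N ⊕ H.graph.C, dcFin U' (H.edgeGp c')) ≃
      (Σ e : H.graph.N, dcFin U' (H.nodeGp e)) ⊕ (Σ c : H.graph.C, dcFin U' (H.cuspGp c)) :=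
    Equiv.sumSigmaDistrib fun c' => dcFin U' (H.edgeGp c')
  let φ : (Σ c : G.graph.N ⊕ G.graph.C, dcFin U (G.edgeGp c)) ≃
      (Σ c' : H.graph.N ⊕ H.graph.C, dcFin U' (H.edgeGp c')) :=
    σG.trans ((ι₀.nodeEquiv.sumCongr ι₀.cuspEquiv).trans σH.symm)
  have hφ_inl : ∀ (e : G.graph.N) (i : dcFin U (G.nodeGp e)),
      φ ⟨Sum.inl e, i⟩ = ⟨Sum.inl (ι₀.nodeEquiv ⟨e, i⟩).1, (ι₀.nodeEquiv ⟨e, i⟩).2⟩ := fun _ _ => rfl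
  have hφ_inr : ∀ (c : G.graph.C) (i : dcFin U (G.cuspGp c)),
      φ ⟨Sum.inr c, i⟩ = ⟨Sum.inr (ι₀.cuspEquiv ⟨c, i⟩).1, (ι₀.cuspEquiv ⟨c, i⟩).2⟩ := fun _ _ => rfl
  -- graphic at the canonical representatives
  have hφ : ∀ w : Σ c, dcFin U (G.edgeGp c), ∃ u' ∈ U',
      (U ⊓ ConjAct.toConjAct (dcRep U (G.edgeGp w.1) w.2) • G.edgeGp w.1).map α.toMulEquiv.toMonoidHom ⊔
          g'.ker.map U'.subtype =
        ConjAct.toConjAct u' • ((U' ⊓ ConjAct.toConjAct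
          (dcRep U' (H.edgeGp (φ w).1) (φ w).2) • H.edgeGp (φ w).1) ⊔ g'.ker.map U'.subtype) := by
    rintro ⟨c | c, i⟩
    · obtain ⟨γ, hγ⟩ := hvia.2.1 ⟨c, i⟩
      rw [hφ_inl]
      exact graphicMod_of_shadow_conj α g g' hs' αU hαU ᾱ hᾱ hγ
    · obtain ⟨γ, hγ⟩ := hvia.2.2 ⟨c, i⟩
      rw [hφ_inr]
      exact graphicMod_of_shadow_conj α g g' hs' αU hαU ᾱ hᾱ hγ
  obtain ⟨e, he⟩ := graphic_mod_bijection_of_reps α G.edgeGp H.edgeGp inferInstance inferInstance hUU'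
    hKn φ hφ
  refine ⟨g'.ker.map U'.subtype, hKn, e, he, fun c₁ y₁ c₂ y₂ h => ?_⟩
  -- separation: the shadows of the edge classes are the edge-like subgroups of `D'`
  refine sep_mod_ker_of_shadow H.edgeGp g' inferInstance hs' hKn
    (fun w => ((ConjAct.toConjAct (dcRep U' (H.edgeGp w.1) w.2) • H.edgeGp w.1).subgroupOf U').map g')
    (fun w => rfl) ?_ c₁ y₁ c₂ y₂ h
  rintro ⟨c₁ | c₁, i₁⟩ ⟨c₂ | c₂, i₂⟩ γ₁ γ₂ hopen
  · have h12 : (Sum.inl ⟨c₁, i₁⟩ : ((H.restrictBD U' hU' bd').mapAlong g' hg' S hSH hne hQ').graph.N ⊕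
        ((H.restrictBD U' hU' bd').mapAlong g' hg' S hSH hne hQ').graph.C) = Sum.inl ⟨c₂, i₂⟩ :=
      hE (Sum.inl ⟨c₁, i₁⟩) (Sum.inl ⟨c₂, i₂⟩) γ₁ γ₂ hopen
    obtain ⟨hc, hi⟩ := Sigma.mk.inj_iff.mp (Sum.inl.inj h12)
    subst hc
    rw [eq_of_heq hi]
  · exact absurd (hE (Sum.inl ⟨c₁, i₁⟩) (Sum.inr ⟨c₂, i₂⟩) γ₁ γ₂ hopen) Sum.inl_ne_inr
  · exact absurd (hE (Sum.inr ⟨c₁, i₁⟩) (Sum.inl ⟨c₂, i₂⟩) γ₁ γ₂ hopen) Sum.inr_ne_inl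
  · have h12 : (Sum.inr ⟨c₁, i₁⟩ : ((H.restrictBD U' hU' bd').mapAlong g' hg' S hSH hne hQ').graph.N ⊕
        ((H.restrictBD U' hU' bd').mapAlong g' hg' S hSH hne hQ').graph.C) = Sum.inr ⟨c₂, i₂⟩ :=
      hE (Sum.inr ⟨c₁, i₁⟩) (Sum.inr ⟨c₂, i₂⟩) γ₁ γ₂ hopen
    obtain ⟨hc, hi⟩ := Sigma.mk.inj_iff.mp (Sum.inr.inj h12)
    subst hc
    rw [eq_of_heq hi]

end Shadow

end PSCDatum

end Literature.AnabelianGeometry.SemiGraphs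

end
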